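import Summits.AnomalousDissipation.AnomalousDissipation.Theses.QuarticLadder
import Summits.AnomalousDissipation.AnomalousDissipation.Theorems.UniformResolution.Negative.Shape
import Summits.AnomalousDissipation.AnomalousDissipation.Theorems.MomentParityUniformResolutionOfResolvedDissipation
import Summits.AnomalousDissipation.AnomalousDissipation.Theorems.MomentParityResolvedDissipationOfLerayHopfEnergyEquality

/-!
# `QuarticLadder.UniformResolution` (stmt-AnomalousDissipation-14330), line `Sketch`:
# the Leray–Hopf energy-equality bracket in the crux's own currency

Support file of the line lead (prover-line-stmt-AnomalousDissipation-14330-c17-0; `--supports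
stmt-AnomalousDissipation-14330`, nothing here closes the item). It lands, as tree theorems, the typed
bracket of the strategist census b1 (`Cruxes/UniformResolution/STRATEGY-CENSUS.md` §0/§Transfer T-b1-1/
§Decomposition D-b1-1/§Negation N-b1-2, companion `StrategistSketchB1.lean`), every arrow a composition of
LANDED theorems:

* `ur_body_of_lhee_along` — per force and per viscosity sequence, SAME budgets: if NS(ν_j, f) has the
  Leray–Hopf energy equality at every `j` (hypothesis verbatim as in the landed
  `LhBracket.resolvedAt_of_lerayHopfEnergyEquality`, stmt-14284's bracket), then loud `d`-wise level
  families at every `j` are RESOLVED loud families at every `j`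
  (`resolvedAt_of_lerayHopfEnergyEquality` ∘ `MomentParityUniformResolution.stub_closure`);
* `uniformResolution_of_lerayHopfEnergyEquality` — the global form `LHEE ⟹ QuarticLadder.UniformResolution`
  (`uniformResolution_of_resolvedDissipation ∘ resolvedDissipation_of_lerayHopfEnergyEquality`; the two route
  decls `QuarticLadder.UniformResolution` / `MomentParity.UniformResolution` have definitionally equal bodies);
* `uniformResolution_of_badClass` — the force-class split assembled: the crux follows from its restriction to
  the forces admitting an energy-DROPPING Leray–Hopf solution at some `ν_j` (the class whose emptiness is the
  3-D Leray–Hopf energy-equality problem);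
* `uniformResolution_of_not_dwise` — the vacuity end: no `d`-wise Galerkin-ensemble zeroth law for any force
  ⟹ the crux (contrapositive of the landed `dwise_of_not_uniformResolution`).

So, all arrows kernel-checked: `¬DwiseGalerkinInvariantLoud ∨ (LHEE along ν_j for the given f) ⟹ UR`. The
energy equality for 3-D Leray–Hopf solutions at fixed `ν > 0` is OPEN (Leray 1934 §34; Lions 1960; Shinbrot
1974; known on the Lions–Shinbrot class, landed `LhBracket.lerayHopfEnergyEquality_of_lionsClass`); these are
CONDITIONAL closures of the crux, credited to nothing, recorded so that the crux chain reads them in tree.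
-/

noncomputable section

-- `Summit.<Summit>.<Problem>` duplicate namespace is the tree's mandated layout for single-conjunct summits.
set_option linter.dupNamespace false

namespace Summit.AnomalousDissipation.AnomalousDissipation.Theorems.QuarticLadderUniformResolution.LhBracket

open MeasureTheory Filter Topology Set
open scoped ENNReal InnerProductSpace RealInnerProductSpace
open Literature.Analysis.FunctionSpaces Literature.Analysis.FluidPDE
open Summit.AnomalousDissipation.AnomalousDissipation.Theorems.QuarticGate.Negative
  (IsLevel IsBandTest polyGrad IsPolyStationary)
open Summit.AnomalousDissipation.AnomalousDissipation.Theorems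
open Summit.AnomalousDissipation.AnomalousDissipation.Theorems.UniformResolution.Negative
  (IsResolved IsLoudFamilyAt IsResolvedLoudFamilyAt DwiseGalerkinInvariantLoud uniformResolution_iff
    dwise_of_not_uniformResolution)

/-! ## The bracket per force, along the viscosity sequence -/

/-- **UR holds, force by force, wherever the Leray–Hopf energy equality holds along the viscosity sequence**
(unchanged budgets). For a smooth mean-zero force `f` and positive `ν_j`: if every global Leray–Hopf weak
solution of NS(ν_j, f) on `T³` satisfies the energy EQUALITY between positive times, for every `j`, then loud
`d`-wise level families at every `j` are RESOLVED loud families at every `j` with the same `(E, ε)`. At each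
`j` the landed bracket gives ONE schedule `κ_j` resolving every all-order-stationary level law in the
antecedent's ball (`LhBracket.resolvedAt_of_lerayHopfEnergyEquality`), and the landed closure
`MomentParityUniformResolution.stub_closure` turns the `d`-wise loud laws into one all-order-stationary loud
law per level. [folklore] -/
theorem ur_body_of_lhee_along (f : UnitAddTorus (Fin 3) → EuclideanSpace ℝ (Fin 3)) (hfs : Torus.IsSmooth f)
    (hfz : Torus.HasZeroMean f) (ν : ℕ → ℝ) (E ε : ℝ) (hν : ∀ j, 0 < ν j)
    (hLHEE : ∀ (j : ℕ) (u₀ : UnitAddTorus (Fin 3) → EuclideanSpace ℝ (Fin 3))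
      (u : ℝ → UnitAddTorus (Fin 3) → EuclideanSpace ℝ (Fin 3)),
      Torus.IsGlobalLerayHopf (ν j) (fun _ => f) u₀ u →
      ∀ (t₀ t₁ : ℝ), 0 < t₀ → t₀ ≤ t₁ →
        Torus.kineticEnergy (u t₁) + ν j * (∫⁻ τ in Ioo t₀ t₁, Torus.eGradNormSq (u τ)).toReal =
          Torus.kineticEnergy (u t₀) + ∫ τ in t₀..t₁, ∫ x, ⟪f x, u τ x⟫_ℝ)
    (hloud : ∀ j, IsLoudFamilyAt f (ν j) E ε) :
    ∀ j, IsResolvedLoudFamilyAt f (ν j) E ε := by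
  intro j
  obtain ⟨R, hfreq⟩ := hloud j
  obtain ⟨κ, hκ⟩ :=
    MomentParityResolvedDissipation.LhBracket.resolvedAt_of_lerayHopfEnergyEquality (hν j) hfs hfz (hLHEE j) R
  refine ⟨R, κ, hfreq.mono fun N hN d => ?_⟩
  obtain ⟨μ, hp, hl, hb, hst, hE, hD⟩ := MomentParityUniformResolution.stub_closure f hfs (ν j) N E ε R hN
  exact ⟨μ, hp, hl, hb, fun n => hκ N μ hp hl hb (fun m g P hg => hst (P.totalDegree + 1) m g P hg le_rfl) n,
    hst d, hE, hD⟩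

/-! ## The global bracket -/

/-- **LHEE ⟹ `QuarticLadder.UniformResolution`.** If every global Leray–Hopf weak solution of NS on `T³` with
a smooth divergence-free mean-zero steady force satisfies the energy equality between positive times (for
every `ν > 0`), the crux holds: `uniformResolution_of_resolvedDissipation ∘
resolvedDissipation_of_lerayHopfEnergyEquality` (the QuarticLadder and MomentParity decls have definitionally
equal bodies). CONDITIONAL on an open classical problem; credited to nothing. [folklore] -/
theorem uniformResolution_of_lerayHopfEnergyEquality :
    (∀ (ν : ℝ), 0 < ν → ∀ (f : UnitAddTorus (Fin 3) → EuclideanSpace ℝ (Fin 3)), Literature.Analysis.FunctionSpaces.Torus.IsSmooth f → Literature.Analysis.FunctionSpaces.Torus.IsDivFree f → Literature.Analysis.FunctionSpaces.Torus.HasZeroMean f → ∀ (u₀ : UnitAddTorus (Fin 3) → EuclideanSpace ℝ (Fin 3)) (u : ℝ → UnitAddTorus (Fin 3) → EuclideanSpace ℝ (Fin 3)), Literature.Analysis.FluidPDE.Torus.IsGlobalLerayHopf ν (fun _ => f) u₀ u → ∀ (t₀ t₁ : ℝ), 0 < t₀ → t₀ ≤ t₁ → Literature.Analysis.FunctionSpaces.Torus.kineticEnergy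 (u t₁) + ν * (MeasureTheory.lintegral (MeasureTheory.volume.restrict (Set.Ioo t₀ t₁)) (fun τ => Literature.Analysis.FunctionSpaces.Torus.eGradNormSq (u τ))).toReal = Literature.Analysis.FunctionSpaces.Torus.kineticEnergy (u t₀) + ∫ τ in t₀..t₁, ∫ x, inner ℝ (f x) (u τ x)) → Summit.AnomalousDissipation.AnomalousDissipation.Theses.QuarticLadder.UniformResolution :=
  fun hLHEE =>
  MomentParityUniformResolution.uniformResolution_of_resolvedDissipation
    (MomentParityResolvedDissipation.LhBracket.resolvedDissipation_of_lerayHopfEnergyEquality hLHEE)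

/-! ## The force-class split, assembled -/

/-- **The crux follows from its restriction to the LHEE-bad forces.** `QuarticLadder.UniformResolution` holds
as soon as its implication holds for every admissible `(f, ν, E, ε)` for which SOME `ν_j` carries a global
Leray–Hopf solution of NS(ν_j, f) violating the energy equality between two positive times: on the
complementary class `ur_body_of_lhee_along` proves it with unchanged budgets (`by_cases`). The bad class is
empty iff the 3-D Leray–Hopf energy equality holds for all smooth steady forces — the typed reason this split
is not filed as two items. [folklore] -/
theorem uniformResolution_of_badClass
    (hbad : ∀ f : UnitAddTorus (Fin 3) → EuclideanSpace ℝ (Fin 3),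
      Torus.IsSmooth f → Torus.IsDivFree f → Torus.HasZeroMean f →
      ∀ (ν : ℕ → ℝ) (E ε : ℝ), (∀ j, 0 < ν j) → Tendsto ν atTop (𝓝 0) → 0 < ε →
      (∃ (j : ℕ) (u₀ : UnitAddTorus (Fin 3) → EuclideanSpace ℝ (Fin 3))
        (u : ℝ → UnitAddTorus (Fin 3) → EuclideanSpace ℝ (Fin 3)),
        Torus.IsGlobalLerayHopf (ν j) (fun _ => f) u₀ u ∧
        ∃ (t₀ t₁ : ℝ), 0 < t₀ ∧ t₀ ≤ t₁ ∧
          Torus.kineticEnergy (u t₁) + ν j * (∫⁻ τ in Ioo t₀ t₁, Torus.eGradNormSq (u τ)).toReal ≠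
            Torus.kineticEnergy (u t₀) + ∫ τ in t₀..t₁, ∫ x, ⟪f x, u τ x⟫_ℝ) →
      (∀ j, IsLoudFamilyAt f (ν j) E ε) →
      ∃ E' ε' : ℝ, 0 < ε' ∧ ∀ j, IsResolvedLoudFamilyAt f (ν j) E' ε') :
    Summit.AnomalousDissipation.AnomalousDissipation.Theses.QuarticLadder.UniformResolution := by
  show Summit.AnomalousDissipation.AnomalousDissipation.Theses.MomentParity.UniformResolution
  rw [uniformResolution_iff]
  intro f hfs hfd hfz ν E ε hν hν0 hε hloud
  by_cases hgood : ∀ (j : ℕ) (u₀ : UnitAddTorus (Fin 3) → EuclideanSpace ℝ (Fin 3))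
      (u : ℝ → UnitAddTorus (Fin 3) → EuclideanSpace ℝ (Fin 3)),
      Torus.IsGlobalLerayHopf (ν j) (fun _ => f) u₀ u →
      ∀ (t₀ t₁ : ℝ), 0 < t₀ → t₀ ≤ t₁ →
        Torus.kineticEnergy (u t₁) + ν j * (∫⁻ τ in Ioo t₀ t₁, Torus.eGradNormSq (u τ)).toReal =
          Torus.kineticEnergy (u t₀) + ∫ τ in t₀..t₁, ∫ x, ⟪f x, u τ x⟫_ℝ
  · exact ⟨E, ε, hε, ur_body_of_lhee_along f hfs hfz ν E ε hν hgood hloud⟩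
  · push Not at hgood
    obtain ⟨j, u₀, u, hLH, t₀, t₁, ht₀, ht₀₁, hne⟩ := hgood
    exact hbad f hfs hfd hfz ν E ε hν hν0 hε ⟨j, u₀, u, hLH, t₀, t₁, ht₀, ht₀₁, hne⟩ hloud

/-! ## The vacuity end -/

/-- **No `d`-wise Galerkin-ensemble zeroth law for ANY force ⟹ the crux holds (vacuously).** Contrapositive
of the landed `dwise_of_not_uniformResolution`; the hypothesis is a NEGATIVE resolution of the
Galerkin-ensemble form of the summit — the typed lower end of the bracket
`¬DwiseGalerkinInvariantLoud ∨ LHEE-along ⟹ UR`. [folklore] -/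
theorem uniformResolution_of_not_dwise (h : ¬ DwiseGalerkinInvariantLoud) :
    Summit.AnomalousDissipation.AnomalousDissipation.Theses.QuarticLadder.UniformResolution := by
  show Summit.AnomalousDissipation.AnomalousDissipation.Theses.MomentParity.UniformResolution
  by_contra hUR
  exact h (dwise_of_not_uniformResolution hUR)

end Summit.AnomalousDissipation.AnomalousDissipation.Theorems.QuarticLadderUniformResolution.LhBracket

end
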